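import Summits.QuantumFields.YangMills.Theorems.BalabanUVNodesN21GappedCollarDesignIResummedPair
import Summits.QuantumFields.YangMills.Theorems.BalabanUVNodesN21TwoRunDominationOfSupCloseness
import Summits.QuantumFields.YangMills.Theorems.BalabanUVNodesN21GappedTopPairReading13CoPHDefs

/-!
# N21 (NE7c) · THE RESUMMED PAIR JUNCTION END-TO-END AT dag-n21-w7's PAIR READING's OWN LETTERS: `cubeStat`-closeness at the scale `ε·δ_K` and sup-closeness of the tested
# fluctuation statistics at the scale `2δ_k·δ′′_K` ⇒ design (i)'s resummed pair deficit at `(θ⋆, δ′⋆) = (cutGrid(i⋆+1), bCutGrid(j⋆+1))` is at most the doubly-gapped deficit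
# `wTop2At − wGap2At` over the collars `[cutGrid(i⋆+2), cutGrid i⋆] × [bCutGrid(j⋆+2), bCutGrid j⋆]` — pointwise, at BOTH selected depths

Track A of `YM-PLAN.md` (cell `pub-ymgap`), node **N21** (NE7c, NOT PRINTED); WIDTH SEAT `pub-ymgap-dag-n21-w2` (gen 3), file 12.  THEOREMS ONLY: 0 `def`, 0 `sorry`; COUNT-NEUTRAL;
`--kind proof --supports stmt-QuantumFields-27366 --as helper` (K3⁸).  Imports this seat's file 8 `…GappedCollarDesignIResummedPair` and file 9 `…TwoRunDominationOfSupCloseness`, and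
dag-n21-w7's `…GappedTopPairReading13CoPHDefs` (p631127 ✓: `selDepthA2₁₃ ∕ selDepthB2₁₃ ∕ _le`).  No Theses import; restates nothing.  The (3.2)-only twin is file 11.

WHY.  dag-n21-w7's pair reading `crGap2₁₃VAt N K₀ jcut ρ ρ′ n₁ n₂` reads run A's class weight at history `K` RE-LETTERED to `θ⋆ := cutGrid ε ρ_K (i⋆+1)` ((3.2), top level `K₀+K`)
and `δ′⋆ := bCutGrid δ_k ρ′_K (j⋆+1)` ((3.3), old level `K₀+K−1`), with `i⋆ = selDepthA2₁₃ …`, `j⋆ = selDepthB2₁₃ …` (their `gapWeight2A₁₃ ∕ gapShell2A₁₃`).  File 8 gives the resummed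
pair junction at ABSTRACT letters from the two ∀∃ domination pairs; file 9 turns SUP-closeness into those pairs; file 2 ∕ file 7 give the collar rows at any depth `≤ n`.  THIS FILE is
the ONE composition at the reading's letters.

WHAT IS PROVED ([bookkeeping] BY NAME).
* ★★★ `pairDeficit_le_gapShell2_at_selDepths_of_close` — at `p := runA₁₃ F K₀ g₀ K`, `g := histA₁₃ θ K₀ g₀ K`, (3.3) level `k`, any run-B data `(p′, g′, k′, ι, s_B, U_B, V_B)`, any
  `s′, U, V′`: (H-ζ) `0 ≤ ζ`; dial rows at `K` for `(ρ, n₁)` w.r.t. `δ` and for `(ρ′, n₂)` w.r.t. `δ′′`; signs `0 ≤ ε_{K₀+K}`, `0 ≤ δ_k`, `0 ≤ δ_K`, `0 ≤ δ′′_K`; `cubeStat`-closeness at scale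
  `ε·δ_K`; nonempty starred bond families and sup-closeness of the tested fluctuation statistics at scale `2δ_k·δ′′_K` ⇒ file 8's deficit inequality at the reading's six letters.

HONEST FRAMING.  Both closenesses are HYPOTHESES (N16's, NOT PRINTED; inhabited for no family here); `ι`, run B's data, the dial rows and the nonemptiness of the starred bond
families are the consumer's (displayed); integration against the dressed slot and the joint two-run law is NOT done here; nothing about `sect3DataOfRecord` ∕ `ukBox` proved; nothing
of Bałaban's asserted; NE7c NOT PRINTED ∕ NOT proved at print's thresholds; **N21 NOT discharged**; K3⁷∕K3⁸ NOT claimed; counts UNMOVED (typed 28∕28 · discharged 5∕27); never a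
count claim.  One finite four-torus programme at fixed `ε` — NOT ℝ⁴, NOT OS, NOT a mass gap, NOT the Clay problem.  No decl below carries a cite tag.
-/

open Finset

namespace Summit.QuantumFields.YangMills.Theorems.N21GappedPairDeficitAtSelectedDepths

open Literature.MathematicalPhysics.QuantumFieldTheory.Balaban1983to89
open Literature.MathematicalPhysics.QuantumFieldTheory.Balaban1983to89.T4Continuum
open Literature.MathematicalPhysics.QuantumFieldTheory.Balaban1983to89.Node00
open B14.Eq216Concrete (ukBox)
open B14.Sect3Decomp (Vbox)
open GaugeField (plaqHol)
open GaugeGroup (dist1)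
open YMDAG.UVSplit (histA₁₃ runA₁₃)
open Summit.QuantumFields.YangMills.Theorems.N21ShellSplitOfRecord13CoPH (cubeStat cutGrid)
open Summit.QuantumFields.YangMills.Theorems.N21GappedTopPair13CoPH (bFactorAt bCutGrid wTop2At wGap2At selDepthA2₁₃ selDepthB2₁₃ selDepthA2₁₃_le selDepthB2₁₃_le)
open Summit.QuantumFields.YangMills.Theorems.N21GappedTopCutDials (collar_rows_of_dials)
open Summit.QuantumFields.YangMills.Theorems.N21GappedCollarDesignIPair (bCollar_rows_of_dials)
open Summit.QuantumFields.YangMills.Theorems.N21GappedCollarDesignIResummedPair (wTop2At_sub_twoRunCore2_le_wTop2At_sub_wGap2At_of_close)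
open Summit.QuantumFields.YangMills.Theorems.N21TwoRunDominationOfSupCloseness (bgDominations_of_cubeStat_close fluctDominations_of_supStat_close)
open scoped BigOperators

variable {F : T4Family} {N : ℕ} [NeZero N]

/-- ★★★ **DESIGN (i)'s RESUMMED PAIR DEFICIT AT THE PAIR READING's LETTERS IS AT MOST THE DOUBLY-GAPPED DEFICIT** — from `cubeStat`-closeness at scale `ε·δ_K`, sup-closeness of
the tested fluctuation statistics at scale `2δ_k·δ′′_K`, (H-ζ), the sign rows and the two dial rows at `K` (run A: `p := runA₁₃ F K₀ g₀ K`, `g := histA₁₃ θ K₀ g₀ K`, (3.3) level `k`;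
letters `θ⋆ = cutGrid(i⋆+1)`, `δ′⋆ = bCutGrid(j⋆+1)`, collars `[cutGrid(i⋆+2), cutGrid i⋆]`, `[bCutGrid(j⋆+2), bCutGrid j⋆]`, `i⋆ = selDepthA2₁₃ …`, `j⋆ = selDepthB2₁₃ …`). [bookkeeping] -/
theorem pairDeficit_le_gapShell2_at_selDepths_of_close (θ : Stage13HParams F N) (hP : θ.Provisos₁₃CoPH F N) (K₀ : ℕ) (g₀ : ℕ → ℝ) (os : List (ULoop F))
    (ρ ρ' : ℕ → ℝ) (n₁ n₂ : ℕ → ℕ) (δ δ'' : ℕ → ℝ) (K : ℕ) (t : ℝ) {k : ℕ}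
    (hζ0 : ∀ p g k s Pl Ql RS U V', 0 ≤ θ.ζ p g k s Pl Ql RS U V')
    {p' : B12.RunParams} {g' : ℕ → ℝ} {k' : ℕ} (ι : Iχ F θ.ν (runA₁₃ F K₀ g₀ K) (histA₁₃ θ K₀ g₀ K) k → Iχ F θ.ν p' g' k')
    (s' : SeqOfRecord F θ.ν θ.τ9.M (histA₁₃ θ K₀ g₀ K) (runA₁₃ F K₀ g₀ K).K (k + 1)) (sB : SeqOfRecord F θ.ν θ.τ9.M g' p'.K k')
    (U : GaugeField (F.P (runA₁₃ F K₀ g₀ K).K) k (SU N)) (V' : GaugeField (F.P (runA₁₃ F K₀ g₀ K).K) (k + 1) (SU N))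
    (UB : GaugeField (F.P p'.K) k' (SU N)) (VB : GaugeField (F.P p'.K) (k' + 1) (SU N))
    (hε : 0 ≤ epsOfRecord θ.ν (histA₁₃ θ K₀ g₀ K) (K₀ + K)) (hδk : 0 ≤ deltaOfRecord θ.ν (histA₁₃ θ K₀ g₀ K) k θ.A₁) (hδ : 0 ≤ δ K) (hδ'' : 0 ≤ δ'' K)
    (hρ0 : 0 ≤ ρ K) (hρ1 : ρ K ≤ 1) (hhalf : (1 : ℝ) / 2 ≤ (1 - ρ K) ^ (n₁ K + 2)) (hcompat : ∀ j, j ≤ n₁ K + 2 → δ K ≤ (1 - ρ K) ^ j * ρ K)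
    (hρ'0 : 0 ≤ ρ' K) (hρ'1 : ρ' K ≤ 1) (hhalf' : (1 : ℝ) / 2 ≤ (1 - ρ' K) ^ (n₂ K + 2)) (hcompat' : ∀ j, j ≤ n₂ K + 2 → δ'' K ≤ (1 - ρ' K) ^ j * ρ' K)
    (hclose : ∀ c : Iχ F θ.ν (runA₁₃ F K₀ g₀ K) (histA₁₃ θ K₀ g₀ K) k,
      |cubeStat F N θ.ν (histA₁₃ θ K₀ g₀ K) (Kc := (runA₁₃ F K₀ g₀ K).K) (k := k + 1) c V' - cubeStat F N θ.ν g' (Kc := p'.K) (k := k' + 1) (ι c) VB| ≤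
        epsOfRecord θ.ν (histA₁₃ θ K₀ g₀ K) (K₀ + K) * δ K)
    (hneA : ∀ c : Iχ F θ.ν (runA₁₃ F K₀ g₀ K) (histA₁₃ θ K₀ g₀ K) k,
      ((sect3DataOfRecord F N θ.ν θ.τ9.M (runA₁₃ F K₀ g₀ K) (histA₁₃ θ K₀ g₀ K) k s'.init).bondsStar c).Nonempty)
    (hneB : ∀ c : Iχ F θ.ν (runA₁₃ F K₀ g₀ K) (histA₁₃ θ K₀ g₀ K) k, ((sect3DataOfRecord F N θ.ν θ.τ9.M p' g' k' sB).bondsStar (ι c)).Nonempty)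
    (hclose' : ∀ c : Iχ F θ.ν (runA₁₃ F K₀ g₀ K) (histA₁₃ θ K₀ g₀ K) k,
      |((sect3DataOfRecord F N θ.ν θ.τ9.M (runA₁₃ F K₀ g₀ K) (histA₁₃ θ K₀ g₀ K) k s'.init).bondsStar c).sup' (hneA c)
          (fun b => dist1 (U b * (Vbox (sect3DataOfRecord F N θ.ν θ.τ9.M (runA₁₃ F K₀ g₀ K) (histA₁₃ θ K₀ g₀ K) k s'.init)
            (avOfRecord F N (runA₁₃ F K₀ g₀ K).K) c V' b)⁻¹)) -
        ((sect3DataOfRecord F N θ.ν θ.τ9.M p' g' k' sB).bondsStar (ι c)).sup' (hneB c)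
          (fun b' => dist1 (UB b' * (Vbox (sect3DataOfRecord F N θ.ν θ.τ9.M p' g' k' sB) (avOfRecord F N p'.K) (ι c) VB b')⁻¹))| ≤
        2 * deltaOfRecord θ.ν (histA₁₃ θ K₀ g₀ K) k θ.A₁ * δ'' K) :
    wTop2At F N θ.toStage9Params
          (cutGrid θ.ν (histA₁₃ θ K₀ g₀ K) (K₀ + K) (ρ K) (selDepthA2₁₃ θ hP K₀ g₀ os ρ (n₁ K) K t + 1))
          (bCutGrid θ.ν θ.A₁ (histA₁₃ θ K₀ g₀ K) k (ρ' K) (selDepthB2₁₃ θ hP K₀ g₀ os ρ' (n₂ K) K t + 1))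
          (runA₁₃ F K₀ g₀ K) (histA₁₃ θ K₀ g₀ K) k s' U V' -
        resumWeights (σOfRecord F θ.ν θ.τ9.M (runA₁₃ F K₀ g₀ K) (histA₁₃ θ K₀ g₀ K) k)
          (fun s lb U V' =>
            (if lb.1 ⊆ cubes32 F θ.ν θ.τ9.M (runA₁₃ F K₀ g₀ K) (histA₁₃ θ K₀ g₀ K) k s then
                (∏ c ∈ cubes32 F θ.ν θ.τ9.M (runA₁₃ F K₀ g₀ K) (histA₁₃ θ K₀ g₀ K) k s \ lb.1,
                    (chiFactorAt F N θ.ν (runA₁₃ F K₀ g₀ K) (histA₁₃ θ K₀ g₀ K) k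
                        (cutGrid θ.ν (histA₁₃ θ K₀ g₀ K) (K₀ + K) (ρ K) (selDepthA2₁₃ θ hP K₀ g₀ os ρ (n₁ K) K t + 1)) c V' *
                      chiFactorAt F N θ.ν p' g' k' (cutGrid θ.ν (histA₁₃ θ K₀ g₀ K) (K₀ + K) (ρ K) (selDepthA2₁₃ θ hP K₀ g₀ os ρ (n₁ K) K t + 1)) (ι c) VB)) *
                  ∏ c ∈ lb.1,
                    ((1 - chiFactorAt F N θ.ν (runA₁₃ F K₀ g₀ K) (histA₁₃ θ K₀ g₀ K) k
                        (cutGrid θ.ν (histA₁₃ θ K₀ g₀ K) (K₀ + K) (ρ K) (selDepthA2₁₃ θ hP K₀ g₀ os ρ (n₁ K) K t + 1)) c V') *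
                      (1 - chiFactorAt F N θ.ν p' g' k' (cutGrid θ.ν (histA₁₃ θ K₀ g₀ K) (K₀ + K) (ρ K) (selDepthA2₁₃ θ hP K₀ g₀ os ρ (n₁ K) K t + 1)) (ι c) VB))
              else 0) *
            (if lb.2.1 ⊆ qcubes F θ.ν θ.τ9.M (runA₁₃ F K₀ g₀ K) (histA₁₃ θ K₀ g₀ K) k s lb.1 then
                (∏ c ∈ qcubes F θ.ν θ.τ9.M (runA₁₃ F K₀ g₀ K) (histA₁₃ θ K₀ g₀ K) k s lb.1 \ lb.2.1,
                    (bFactorAt F N θ.ν θ.τ9.M (runA₁₃ F K₀ g₀ K) (histA₁₃ θ K₀ g₀ K) k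
                        (bCutGrid θ.ν θ.A₁ (histA₁₃ θ K₀ g₀ K) k (ρ' K) (selDepthB2₁₃ θ hP K₀ g₀ os ρ' (n₂ K) K t + 1)) s c U V' *
                      bFactorAt F N θ.ν θ.τ9.M p' g' k' (bCutGrid θ.ν θ.A₁ (histA₁₃ θ K₀ g₀ K) k (ρ' K) (selDepthB2₁₃ θ hP K₀ g₀ os ρ' (n₂ K) K t + 1)) sB (ι c) UB VB)) *
                  ∏ c ∈ lb.2.1,
                    ((1 - bFactorAt F N θ.ν θ.τ9.M (runA₁₃ F K₀ g₀ K) (histA₁₃ θ K₀ g₀ K) k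
                        (bCutGrid θ.ν θ.A₁ (histA₁₃ θ K₀ g₀ K) k (ρ' K) (selDepthB2₁₃ θ hP K₀ g₀ os ρ' (n₂ K) K t + 1)) s c U V') *
                      (1 - bFactorAt F N θ.ν θ.τ9.M p' g' k' (bCutGrid θ.ν θ.A₁ (histA₁₃ θ K₀ g₀ K) k (ρ' K) (selDepthB2₁₃ θ hP K₀ g₀ os ρ' (n₂ K) K t + 1)) sB (ι c) UB VB))
              else 0) *
              θ.ζ (runA₁₃ F K₀ g₀ K) (histA₁₃ θ K₀ g₀ K) k s lb.1 lb.2.1 lb.2.2 U V')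
          s' U V' ≤
      wTop2At F N θ.toStage9Params
          (cutGrid θ.ν (histA₁₃ θ K₀ g₀ K) (K₀ + K) (ρ K) (selDepthA2₁₃ θ hP K₀ g₀ os ρ (n₁ K) K t + 1))
          (bCutGrid θ.ν θ.A₁ (histA₁₃ θ K₀ g₀ K) k (ρ' K) (selDepthB2₁₃ θ hP K₀ g₀ os ρ' (n₂ K) K t + 1))
          (runA₁₃ F K₀ g₀ K) (histA₁₃ θ K₀ g₀ K) k s' U V' -
        wGap2At F N θ.toStage9Params
          (cutGrid θ.ν (histA₁₃ θ K₀ g₀ K) (K₀ + K) (ρ K) (selDepthA2₁₃ θ hP K₀ g₀ os ρ (n₁ K) K t + 2))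
          (cutGrid θ.ν (histA₁₃ θ K₀ g₀ K) (K₀ + K) (ρ K) (selDepthA2₁₃ θ hP K₀ g₀ os ρ (n₁ K) K t))
          (bCutGrid θ.ν θ.A₁ (histA₁₃ θ K₀ g₀ K) k (ρ' K) (selDepthB2₁₃ θ hP K₀ g₀ os ρ' (n₂ K) K t + 2))
          (bCutGrid θ.ν θ.A₁ (histA₁₃ θ K₀ g₀ K) k (ρ' K) (selDepthB2₁₃ θ hP K₀ g₀ os ρ' (n₂ K) K t))
          (runA₁₃ F K₀ g₀ K) (histA₁₃ θ K₀ g₀ K) k s' U V' := by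
  obtain ⟨hAB, hBA⟩ := bgDominations_of_cubeStat_close F N θ.ν ι V' VB hclose
  obtain ⟨hAB', hBA'⟩ := fluctDominations_of_supStat_close F N θ.ν θ.τ9.M ι s'.init sB U V' UB VB hneA hneB hclose'
  obtain ⟨hlo, hhi, -, -⟩ := collar_rows_of_dials θ.ν (histA₁₃ θ K₀ g₀ K) (K₀ + K) hε hρ0 hρ1 hhalf hcompat (selDepthA2₁₃_le θ hP K₀ g₀ os ρ (n₁ K) K t)
  obtain ⟨hlo', hhi', -, -⟩ := bCollar_rows_of_dials θ.ν θ.A₁ (histA₁₃ θ K₀ g₀ K) k hδk hρ'0 hρ'1 hhalf' hcompat' (selDepthB2₁₃_le θ hP K₀ g₀ os ρ' (n₂ K) K t)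
  exact wTop2At_sub_twoRunCore2_le_wTop2At_sub_wGap2At_of_close F N θ.toStage9Params hζ0 ι s' sB U V' UB VB (mul_nonneg hε hδ)
    (mul_nonneg (mul_nonneg zero_le_two hδk) hδ'') hAB hBA hAB' hBA' hlo hhi hlo' hhi'

end Summit.QuantumFields.YangMills.Theorems.N21GappedPairDeficitAtSelectedDepths
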